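import Summits.QuantumFields.YangMills.Theorems.BalabanUVNodesN18AtRateRecord13
import Literature.MathematicalPhysics.QuantumFieldTheory.Balaban1983to89.Node00.HistoryGermReading

/-!
# BalabanUVNodes ∕ node N18 = NE5 — THE JUNCTION AT GERM CARRIERS: THE END run on W1-14's germ reading of the history, with the insertion leaves
# L08 ∕ L09 DISCHARGED BY CONSTRUCTION and the size leaves L05 ∕ L06 DISCHARGED from the (1.18) class, composed with the restriction face onto N18's
# statement of record at a Stage-13 tuple (Track A, DAG node N18 = `T4OutputRate.NE5` :211; cluster K4 «SpineRates», item K3⁷ `SpineGivenEndpointR13SepCoPH`;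
# module 20 of seat pub-ymgap-dag-n18-d, strategy s2)

HONEST FRAMING.  Count-neutral kernel bookkeeping (`--supports stmt-QuantumFields-20544 --as helper`), composition BY NAME of landed theorems: THE END
(`Spine.NE5.LeafIndex.ne5_of_leaves_fibre`), module 9's envelope road (`analytic_and_bounded_locE_param_of_geometry` on the torus catalogue), node00-def-W1's
W1-14 `Node00/HistoryGermReading` (p551984) and this seat's module 18.  NE5 is NOT PRINTED and NOT proved; N18 is NOT discharged; the displayed block below
(representation `hrep`, NODE-A majorant `hH`, L01–L03, L07, L10, the sharp clause) is NODE A's ∕ rows NE2–NE3's content; the configuration transport `Tcfg` is a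
PARAMETER with its two laws as hypotheses (background face `hTcfg`, table clause `hTsp` = closure-ledger (iii) complexified); nothing of Bałaban's is asserted.

WHY (closure ledger (i), 2026-08-27).  Module 18 §1 `n18At_u3OfRecord₁₃_readingAdm_of_envelope_bound238` reads THE END's data-direction block (i) as a
`StepModel` over `(LevelPairing.ofRecordAdm …).carriers` = W1's `histCarriers` (tables = the history's REAL VALUES at ONE admissible background).  node00-def-W1
g18's design verdict (`pub-ymgap-node00-def-W1/DESIGN-W1-14-StepModelOfRecord.md`; this seat's (γ) ruling, bus 2026-08-27) found that block unwitnessable faithfully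
(print's step [II] (2.14) reads the older terms as GERMS on the analyticity tables; over `histCarriers` a table-reading witness asserts an unprinted identity and a
channel witness is circular at L08) and typed the repair: the GERM CARRIERS `W1.germCarriers F M N k sp` (index = run-A domain × a point of run B's table at the
paired domain × Re∕Im), the germ functionals `W1.EAgerm S Tcfg ∕ W1.EBgerm S′ b`, the history half OF RECORD `W1.histStepModel` (both runs insert their germ
tables by ONE weighted restriction `insOfRecord`) with the insertion leaves as theorems, the size faces from W1-13's (1.18) class, and the RESTRICTION FACE
`W1.ne5_readingAdm_of_germ` (germ-NE5 ⟹ NE5 of record).  This file is the junction at those carriers: module 18 §1 with block (i) REPLACED by the germ block —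
five leaves fewer (L08, L09aff, L09blind, L09hom, L09unit hold by construction), `AnalyticH`∕`Bound238` replaced by the two (1.18) size classes.

WHAT.
* §1 `outputEnvelope_of_activities_germCarriers` — module 9 §1 over `W1.germCarriers`: for ANY step model over the germ carriers whose output at the germ index
  `I = (⟨j, Y⟩, ψ, τ)` IS (2.13) of scale-`j` activities `act I` on the `k`-th torus's catalogue (`hrep`), the NODE-A majorant per index (`hH`) and the located
  numerals give `OutputEnvelope W κ (e·9·64·K₀(64,8)²·A)`.
* §2 `ne5_of_leaves_fibre_activities_germCarriers_eps` — E1′ at germ carriers, every leaf displayed (`ne5_of_leaves_fibre` BY NAME, W2 from §1).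
* §3 ★ `ne5_germ_of_histStepModel` — AT W1's history half of record `W1.histStepModel … (Out) (opA) (opB) (Base) (rOp) (rHist) … κ c ω`: L08 ∕ L09* by W1's faces,
  L05 ∕ L06 by `W1.decayBound_EAgerm∕EBgerm_of_sizeAdm`; displayed: `hrep`, `hH`, L01, L02, L03, L07, numerals, L10, sharp clause, `hTsp`.
* §4 ★ `n18At_u3OfRecord₁₃_readingAdm_of_germEnd` — per Stage-13 tuple and run length: §3 for every member `b ∈ ]0, γ′]` + `W1.ne5_readingAdm_of_germ` (`hTcfg`) +
  module 18 §1's `Iff.rfl` face + `n18At_mono` ⇒ `N18At (u3OfRecord₁₃ θ ((ReadingData.ofRecordAdm F θ.τ9.M N S sp gauge hg T₀ hT₀ li).u3Objects θ.γ) k)`.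

One finite four-torus programme at fixed `ε`; NOT the continuum limit, NOT OS, NOT a mass gap, NOT Clay.  0 `def`, 0 `sorry`.

Sources: T. Bałaban, CMP **109** (1987) [Balaban1987RG1] (0.24)–(0.25) p. 257, Thm 1 p. 259, (1.18) p. 263; CMP **116** (1988) [Balaban1988RG2Cluster]
(1.24) p. 7, (1.33) p. 9, (2.13)–(2.14) pp. 14–15, Lemma 3 (2.38) p. 20; R. Kotecký–D. Preiss, CMP **103** (1986) [KoteckyPreiss1986].
-/

noncomputable section

open Set Metric
open scoped Matrix.Norms.L2Operator

namespace YMDAG.N18.W1Reading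

open Literature.MathematicalPhysics.QuantumFieldTheory.Balaban1983to89
open Literature.MathematicalPhysics.QuantumFieldTheory.Balaban1983to89.T4Continuum
open Literature.MathematicalPhysics.QuantumFieldTheory.Balaban1983to89.T4OutputRate (Carriers Functional NE5 DecayBound Window)
open Literature.MathematicalPhysics.QuantumFieldTheory.Balaban1983to89.T4InputCauchyRateData (StepModel)
open Literature.MathematicalPhysics.QuantumFieldTheory.Balaban1983to89.B13Resummation (locE)
open Literature.MathematicalPhysics.QuantumFieldTheory.Balaban1983to89.TreeLengthTorus (TDom tsys torusTreeLen)
open Literature.MathematicalPhysics.QuantumFieldTheory.Balaban1983to89.TreeLengthTorusGeometry (TTouch tgeometry)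
open Literature.MathematicalPhysics.QuantumFieldTheory.Balaban1983to89.B12TreeDecay (K₀)
open Literature.MathematicalPhysics.QuantumFieldTheory.Balaban1983to89.Node00 (Stage13Params prependCoupling MatA ιSU)
open Literature.MathematicalPhysics.QuantumFieldTheory.Balaban1983to89.Node00.Sect2 (domCount domSys CPair ofBackgroundC)
open Literature.MathematicalPhysics.QuantumFieldTheory.Balaban1983to89.Node00.W1 (ReadingData LevelPairing LetterInputs ClusterTower pairOfRecord functionalC
  termC box GermIdx germCarriers EAgerm EBgerm GHist histStepModel SizeAdm AdmBg)
open Summit.QuantumFields.BalabanUV.T4Continuum.Spine.NE5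
open Summit.QuantumFields.BalabanUV.T4Continuum.NE1p.DressedOutputAnalyticFaces (analytic_and_bounded_locE_param_of_geometry)
open Summit.QuantumFields.BalabanUV.T4Continuum.NE1p.DressedSmallFieldGeometry (torus_consts)
open Summit.QuantumFields.BalabanUV.T4Continuum.NE1p.DressedSmallFieldGeometryFaces (K₀_four)
open Summit.QuantumFields.YangMills.BalabanUVNodes.N18AtByName (n18At_mono)
open Summit.QuantumFields.YangMills.BalabanUVNodes.N18Knit (ne5_mono)
open YMDAG.UVSplit

/-! ## §1 The output envelope from H-layer data ON THE GERM CARRIERS -/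

section Germ

variable (F : T4Family) (M N : ℕ) (k : ℕ) (sp : (k j : ℕ) → (domSys (F.P k) M j).Dom → Set (CPair (F.P k) (MatA N)))
variable {Op Hist : Type*} [NormedAddCommGroup Op] [NormedSpace ℂ Op] [NormedAddCommGroup Hist] [NormedSpace ℂ Hist]
  (Mdl : StepModel (germCarriers F M N k sp) Op Hist)
variable [∀ j, DecidableEq (TDom 4 (domCount (F.P k) M j))] [∀ j, DecidableRel (TTouch (d := 4) (N := domCount (F.P k) M j))]

/-- **THE OUTPUT ENVELOPE FROM H-LAYER DATA ON THE GERM CARRIERS** [bookkeeping; module 9 §1 `outputEnvelope_of_activities_histCarriers` with the domain index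
replaced by the GERM INDEX `I = (⟨j, Y⟩, ψ, τ)` (`scale I = j`, `d I = d_j(Y)` by definition of `W1.germCarriers`), proof verbatim]: for a step model over the germ
carriers whose output at `I` IS (2.13) of scale-`j` activities `act I` on the `k`-th torus's catalogue (`hrep`; the activities may depend on the table point and the
Re∕Im tag), the NODE-A majorant `hH` near every admissible box and the located numerals give `OutputEnvelope W κ (e·9·64·K₀(64,8)²·A)`.
[cite: Balaban1988RG2Cluster, Lemma 3 (2.38) p.20 and (2.14) p.15; KoteckyPreiss1986, Thm 1 p.492] -/
theorem outputEnvelope_of_activities_germCarriers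
    {act : (I : GermIdx F M N k sp) → Op × Hist → TDom 4 (domCount (F.P k) M I.1.1) → ℂ} {W : Set (ℕ → ℝ)} {A Rd κ : ℝ}
    (hrep : ∀ (I : GermIdx F M N k sp) (z : Op × Hist),
      Mdl.Out I.1.1 z.1 z.2 I =
        locE (TTouch (d := 4) (N := domCount (F.P k) M I.1.1)) (fun Z : (tsys 4 (domCount (F.P k) M I.1.1)).Dom => Z.1) (act I z) I.1.2.1)
    (hA : 0 ≤ A) (hκ : 0 ≤ κ) (hrate : κ + 2 * (64 * Real.log 162) + 2 ≤ Rd)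
    (hsmall : A * Real.exp (5 * κ + 1) * K₀ 64 8 * 9 * 64 ≤ 1)
    (hH : ∀ (I : GermIdx F M N k sp), ∀ g ∈ W, ∀ (U : Unit) (q : Op × Hist), q ∈ Mdl.Base I.1.1 g U →
      ∃ V : Set (Op × Hist), IsOpen V ∧ Mdl.box I.1.1 q ⊆ V ∧
        (∀ Z : TDom 4 (domCount (F.P k) M I.1.1), DifferentiableOn ℂ (fun z : Op × Hist => act I z Z) V) ∧
        (∀ z ∈ V, ∀ Z : TDom 4 (domCount (F.P k) M I.1.1), ‖act I z Z‖ ≤ A * Real.exp (-(Rd * torusTreeLen Z.1)))) :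
    Mdl.OutputEnvelope W κ (Real.exp 1 * 9 * 64 * K₀ 64 8 ^ 2 * A) := by
  intro n g hg U q hq I hI
  obtain ⟨⟨j, Y⟩, ψ, τ⟩ := I
  change j = n at hI
  subst hI
  obtain ⟨V, hV, hbox, hhol, hmaj⟩ := hH ⟨⟨j, Y⟩, ψ, τ⟩ g hg U q hq
  obtain ⟨hν, hκ₀, hc₁⟩ := torus_consts (domCount (F.P k) M j)
  have hK := K₀_four (N := domCount (F.P k) M j)
  letI : DecidableEq (tsys 4 (domCount (F.P k) M j)).Dom := inferInstanceAs (DecidableEq (TDom 4 (domCount (F.P k) M j)))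
  letI : DecidableRel (tgeometry 4 (domCount (F.P k) M j)).ι :=
    inferInstanceAs (DecidableRel (TTouch (d := 4) (N := domCount (F.P k) M j)))
  obtain ⟨hdiff, hbd⟩ :=
    analytic_and_bounded_locE_param_of_geometry (tgeometry 4 (domCount (F.P k) M j)) (P := Op × Hist)
      (m := fun Z : (tsys 4 (domCount (F.P k) M j)).Dom => A * Real.exp (-(Rd * torusTreeLen Z.1))) (act := act ⟨⟨j, Y⟩, ψ, τ⟩) (R := Rd) Y
      hV hA hκ (by rw [hκ₀]; exact hrate) (by rw [hK, hν, hc₁]; exact hsmall) (fun Z _ => hhol Z)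
      (fun z hz Z _ => hmaj z hz Z) (fun Z _ => le_rfl)
  rw [hν, hc₁, hK] at hbd
  refine ⟨(hdiff.mono hbox).congr fun z _ => hrep ⟨⟨j, Y⟩, ψ, τ⟩ z, fun z hz => ?_⟩
  have hbd' : ‖locE (TTouch (d := 4) (N := domCount (F.P k) M j)) (fun Z : (tsys 4 (domCount (F.P k) M j)).Dom => Z.1) (act ⟨⟨j, Y⟩, ψ, τ⟩ z) Y.1‖ ≤
      Real.exp 1 * 9 * 64 * K₀ 64 8 ^ 2 * A * Real.exp (-(κ * torusTreeLen Y.1)) := hbd z (hbox hz)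
  rw [hrep ⟨⟨j, Y⟩, ψ, τ⟩ z]
  exact hbd'

/-! ## §2 E1′ on the germ carriers, every leaf displayed -/

/-- **E1′ ON THE GERM CARRIERS AT MAJORANT CONSTANT `C₃·ε₁`, EVERY LEAF DISPLAYED** [bookkeeping] — `LeafIndex.ne5_of_leaves_fibre` BY NAME over
`W1.germCarriers F M N k sp`, its W2 leaves manufactured from §1's envelope, the sharp clause via `SmallnessPrintedKind.smallness_of_eps`; conclusion
`NE5 EA EB W κ θ′ C₅(C₃ε₁)` for ANY functionals on the germ carriers. [cite: Balaban1988RG2Cluster, Lemma 3 (2.38)–(2.40) p.20; Balaban1987RG1, Thm 1 p.259] -/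
theorem ne5_of_leaves_fibre_activities_germCarriers_eps
    {act : (I : GermIdx F M N k sp) → Op × Hist → TDom 4 (domCount (F.P k) M I.1.1) → ℂ} {W : Set (ℕ → ℝ)} {C3 ε₁ Rd κ : ℝ}
    (hrep : ∀ (I : GermIdx F M N k sp) (z : Op × Hist),
      Mdl.Out I.1.1 z.1 z.2 I =
        locE (TTouch (d := 4) (N := domCount (F.P k) M I.1.1)) (fun Z : (tsys 4 (domCount (F.P k) M I.1.1)).Dom => Z.1) (act I z) I.1.2.1)
    (hC3 : 0 ≤ C3) (hε₁ : 0 ≤ ε₁) (hκ : 0 ≤ κ) (hrate : κ + 2 * (64 * Real.log 162) + 2 ≤ Rd)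
    (hKP : C3 * ε₁ * Real.exp (5 * κ + 1) * K₀ 64 8 * 9 * 64 ≤ 1)
    (hH : ∀ (I : GermIdx F M N k sp), ∀ g ∈ W, ∀ (U : Unit) (q : Op × Hist), q ∈ Mdl.Base I.1.1 g U →
      ∃ V : Set (Op × Hist), IsOpen V ∧ Mdl.box I.1.1 q ⊆ V ∧
        (∀ Z : TDom 4 (domCount (F.P k) M I.1.1), DifferentiableOn ℂ (fun z : Op × Hist => act I z Z) V) ∧
        (∀ z ∈ V, ∀ Z : TDom 4 (domCount (F.P k) M I.1.1), ‖act I z Z‖ ≤ C3 * ε₁ * Real.exp (-(Rd * torusTreeLen Z.1))))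
    {EA : Functional (germCarriers F M N k sp) Unit} {EB : Functional (germCarriers F M N k sp) Unit}
    {EA₀ E₀ E₁ δ δ' θ θ' cH ω ρ₀ B : ℝ} {k₀ : ℕ}
    (l01 : L01 Mdl EA W) (l02 : L02 Mdl EB W) (l03 : L03 Mdl EB W) (l05 : L05 EA W EA₀ κ) (l06 : L06 EB W E₀ κ)
    (l07 : L07 Mdl W δ θ) (l08 : L08 Mdl W κ E₀ δ' θ) (l09aff : L09aff Mdl W) (l09blind : L09blind Mdl W) (l09hom : L09hom Mdl W)
    (l09unit : L09unit Mdl W κ E₁ cH ω) (hE₁ : 0 < E₁) (hδ : 0 ≤ δ + δ') (hθ : 0 ≤ θ) (hθθ' : θ ≤ θ') (hθ'1 : θ' ≤ 1)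
    (hcH : 0 ≤ cH) (hω : 0 < ω) (hρ₀ : ρ₀ < 1) (l10near : (δ + δ') * θ ^ k₀ + cH * (EA₀ + E₀) / (1 - ω) ≤ ρ₀) (hB : 0 ≤ B)
    (l10first : ∀ k < k₀, EA₀ + E₀ ≤ B * θ ^ k)
    (hS : Real.exp 1 * 9 * 64 * K₀ 64 8 ^ 2 * C3 * cH * ε₁ < (θ' - ω) * (1 - ρ₀)) :
    NE5 EA EB W κ θ'
      ((Real.exp 1 * 9 * 64 * K₀ 64 8 ^ 2 * (C3 * ε₁) / (1 - ρ₀) * (δ + δ') + B) * (θ' - ω) /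
        (θ' - (ω + Real.exp 1 * 9 * 64 * K₀ 64 8 ^ 2 * (C3 * ε₁) / (1 - ρ₀) * cH))) := by
  have l11 : ω + Real.exp 1 * 9 * 64 * K₀ 64 8 ^ 2 * (C3 * ε₁) / (1 - ρ₀) * cH < θ' := by
    have h := smallness_of_eps (G := Real.exp 1 * 9 * 64 * K₀ 64 8 ^ 2 * C3) (cI := cH) (ε₁ := ε₁) hρ₀ hS
    have heq : Real.exp 1 * 9 * 64 * K₀ 64 8 ^ 2 * C3 / (1 - ρ₀) * (cH * ε₁) =
        Real.exp 1 * 9 * 64 * K₀ 64 8 ^ 2 * (C3 * ε₁) / (1 - ρ₀) * cH := by ring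
    rwa [heq] at h
  have henv := outputEnvelope_of_activities_germCarriers F M N k sp Mdl hrep (mul_nonneg hC3 hε₁) hκ hrate hKP hH
  exact ne5_of_leaves_fibre Mdl l01 l02 l03 (Mdl.opFibreEnvelope_of_outputEnvelope henv) (Mdl.histFibreEnvelope_of_outputEnvelope henv)
    l05 l06 l07 l08 l09aff l09blind l09hom l09unit hE₁ (by positivity) hδ hθ hθθ' hθ'1 hcH hω hρ₀ l10near hB l10first l11

end Germ

/-! ## §3 At W1's history half of record: the insertion and size leaves discharged -/

section HistModel

variable (F : T4Family) (M N : ℕ) (k : ℕ) (sp : (k j : ℕ) → (domSys (F.P k) M j).Dom → Set (CPair (F.P k) (MatA N)))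
variable {Op : Type} [NormedAddCommGroup Op] [NormedSpace ℂ Op]
variable [∀ j, DecidableEq (TDom 4 (domCount (F.P k) M j))] [∀ j, DecidableRel (TTouch (d := 4) (N := domCount (F.P k) M j))]

/-- ★ **GERM-NE5 AT W1's HISTORY HALF OF RECORD, INSERTION AND SIZE LEAVES DISCHARGED** [bookkeeping; §2 at the member-indexed step models
`Mb b := W1.histStepModel … (Out b) (opA b) (opB b) (Base b) (rOp b) (rHist b) … κ c ω` over the germ carriers].  DISCHARGED BY NAME: L08 (`W1.insertionRate_histStepModel`,
`δ′ = 0`), L09aff ∕ L09blind ∕ L09hom (`W1.insAffine ∕ insBlind ∕ insHomog_histStepModel`), L09unit (`W1.insScaleBound_histStepModel`, `cH := c`), L05 (`W1.decayBound_EAgerm_of_sizeAdm`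
from run A's (1.18) size class `hszA` on the tables `sp k` AND the TABLE CLAUSE `hTsp` of the configuration transport), L06 (`W1.decayBound_EBgerm_of_sizeAdm` from run B's
size class `hszB` at every member).  DISPLAYED (the genuine content, NODE A's ∕ rows NE2–NE3's): the representation `hrep` of the output map by scale-`j` activities per germ
index, the NODE-A majorant `hH`, L01 ∕ L02 (the two runs' germ functionals ARE the output map at the runs' data), L03 (base), L07 (operator rate), the located
numerals, L10, the sharp clause.  Conclusion: `NE5` over `W1.germCarriers` for run A's germ functional `EAgerm (S k) Tcfg` and run B's germ family `EBgerm (S (k+1)) b`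
at every member `b ∈ ]0, γ′]`, window `]0, γ′]^ℕ`, rate `θ′`, constant `C₅(C₃ε₁)` with `δ′ = 0`, `cH = c`.  NOT PRINTED; NOT proved.
[cite: Balaban1988RG2Cluster, (2.13)–(2.14) pp.14–15, (1.24) p.7, (1.33) p.9, Lemma 3 (2.38) p.20; Balaban1987RG1, (1.18) p.263 and Thm 1 p.259] -/
theorem ne5_germ_of_histStepModel (S : (k : ℕ) → ClusterTower (F.P k) (MatA N) M)
    (Tcfg : CPair (F.P (k + 1)) (MatA N) → CPair (F.P k) (MatA N))
    (hTsp : ∀ (X : Node00.W1.Dom (F.P k) M) (ψ : CPair (F.P (k + 1)) (MatA N)),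
      ψ ∈ sp (k + 1) (pairOfRecord F M k X).1 (pairOfRecord F M k X).2 → Tcfg ψ ∈ sp k X.1 X.2)
    (Out : ℝ → ℕ → Op → GHist F M N k sp → GermIdx F M N k sp → ℂ) (opA opB : ℝ → (ℕ → ℝ) → Unit → ℕ → Op)
    (Base : ℝ → ℕ → (ℕ → ℝ) → Unit → Set (Op × GHist F M N k sp)) (rOp rHist : ℝ → ℕ → ℝ) (hrOp : ∀ b n, 0 < rOp b n) (hrHist : ∀ b n, 0 < rHist b n)
    {κ c ω : ℝ} (act : ℝ → (I : GermIdx F M N k sp) → Op × GHist F M N k sp → TDom 4 (domCount (F.P k) M I.1.1) → ℂ)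
    {γ' C3 ε₁ Rd EA₀ E₀ E₁ δ θr θ' ρ₀ B : ℝ} {k₀ : ℕ}
    (hrep : ∀ b : ℝ, 0 < b → b ≤ γ' → ∀ (I : GermIdx F M N k sp) (z : Op × GHist F M N k sp),
      Out b I.1.1 z.1 z.2 I =
        locE (TTouch (d := 4) (N := domCount (F.P k) M I.1.1)) (fun Z : (tsys 4 (domCount (F.P k) M I.1.1)).Dom => Z.1) (act b I z) I.1.2.1)
    (hC3 : 0 ≤ C3) (hε₁ : 0 ≤ ε₁) (hκ : 0 ≤ κ) (hrate : κ + 2 * (64 * Real.log 162) + 2 ≤ Rd)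
    (hKP : C3 * ε₁ * Real.exp (5 * κ + 1) * K₀ 64 8 * 9 * 64 ≤ 1)
    (hH : ∀ b : ℝ, 0 < b → b ≤ γ' → ∀ (I : GermIdx F M N k sp), ∀ g ∈ Window γ', ∀ (U : Unit) (q : Op × GHist F M N k sp), q ∈ Base b I.1.1 g U →
      ∃ V : Set (Op × GHist F M N k sp), IsOpen V ∧
        (histStepModel F M N k sp (Out b) (opA b) (opB b) (Base b) (rOp b) (rHist b) (hrOp b) (hrHist b) κ c ω).box I.1.1 q ⊆ V ∧
        (∀ Z : TDom 4 (domCount (F.P k) M I.1.1), DifferentiableOn ℂ (fun z : Op × GHist F M N k sp => act b I z Z) V) ∧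
        (∀ z ∈ V, ∀ Z : TDom 4 (domCount (F.P k) M I.1.1), ‖act b I z Z‖ ≤ C3 * ε₁ * Real.exp (-(Rd * torusTreeLen Z.1))))
    (l01 : ∀ b : ℝ, 0 < b → b ≤ γ' →
      L01 (histStepModel F M N k sp (Out b) (opA b) (opB b) (Base b) (rOp b) (rHist b) (hrOp b) (hrHist b) κ c ω) (EAgerm F M N k sp (S k) Tcfg) (Window γ'))
    (l02 : ∀ b : ℝ, 0 < b → b ≤ γ' →
      L02 (histStepModel F M N k sp (Out b) (opA b) (opB b) (Base b) (rOp b) (rHist b) (hrOp b) (hrHist b) κ c ω) (EBgerm F M N k sp (S (k + 1)) b) (Window γ'))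
    (l03 : ∀ b : ℝ, 0 < b → b ≤ γ' →
      L03 (histStepModel F M N k sp (Out b) (opA b) (opB b) (Base b) (rOp b) (rHist b) (hrOp b) (hrHist b) κ c ω) (EBgerm F M N k sp (S (k + 1)) b) (Window γ'))
    (hszA : ∀ g ∈ Window γ', ∀ K : ℕ, (fun (j : Fin (K + 1)) Y ψ => termC (S k) j Y g ψ) ∈ SizeAdm (sp k) EA₀ κ K)
    (hszB : ∀ b : ℝ, 0 < b → b ≤ γ' → ∀ g ∈ Window γ', ∀ K : ℕ,
      (fun (j : Fin (K + 1)) Y ψ => termC (S (k + 1)) j Y (prependCoupling b g) ψ) ∈ SizeAdm (sp (k + 1)) E₀ κ K)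
    (l07 : ∀ b : ℝ, 0 < b → b ≤ γ' →
      L07 (histStepModel F M N k sp (Out b) (opA b) (opB b) (Base b) (rOp b) (rHist b) (hrOp b) (hrHist b) κ c ω) (Window γ') δ θr)
    (hE₁ : 0 < E₁) (hδ : 0 ≤ δ) (hθ : 0 ≤ θr) (hθθ' : θr ≤ θ') (hθ'1 : θ' ≤ 1) (hc : 0 ≤ c) (hω : 0 < ω) (hρ₀ : ρ₀ < 1)
    (l10near : δ * θr ^ k₀ + c * (EA₀ + E₀) / (1 - ω) ≤ ρ₀) (hB : 0 ≤ B) (l10first : ∀ k < k₀, EA₀ + E₀ ≤ B * θr ^ k)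
    (hS : Real.exp 1 * 9 * 64 * K₀ 64 8 ^ 2 * C3 * c * ε₁ < (θ' - ω) * (1 - ρ₀))
    (b : ℝ) (hb : 0 < b) (hbγ : b ≤ γ') :
    NE5 (C := germCarriers F M N k sp) (EAgerm F M N k sp (S k) Tcfg) (EBgerm F M N k sp (S (k + 1)) b) (Window γ') κ θ'
      ((Real.exp 1 * 9 * 64 * K₀ 64 8 ^ 2 * (C3 * ε₁) / (1 - ρ₀) * (δ + 0) + B) * (θ' - ω) /
        (θ' - (ω + Real.exp 1 * 9 * 64 * K₀ 64 8 ^ 2 * (C3 * ε₁) / (1 - ρ₀) * c))) := by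
  have hδ0 : 0 ≤ δ + 0 := by rw [add_zero]; exact hδ
  have l10near' : (δ + 0) * θr ^ k₀ + c * (EA₀ + E₀) / (1 - ω) ≤ ρ₀ := by rw [add_zero]; exact l10near
  exact ne5_of_leaves_fibre_activities_germCarriers_eps F M N k sp
    (histStepModel F M N k sp (Out b) (opA b) (opB b) (Base b) (rOp b) (rHist b) (hrOp b) (hrHist b) κ c ω) (hrep b hb hbγ) hC3 hε₁ hκ hrate hKP
    (hH b hb hbγ) (l01 b hb hbγ) (l02 b hb hbγ) (l03 b hb hbγ)
    (Node00.W1.decayBound_EAgerm_of_sizeAdm (S k) Tcfg hTsp (Window γ') EA₀ κ hszA)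
    (Node00.W1.decayBound_EBgerm_of_sizeAdm (S (k + 1)) b (Window γ') E₀ κ (hszB b hb hbγ))
    (l07 b hb hbγ)
    (Node00.W1.insertionRate_histStepModel F M N k sp (Out b) (opA b) (opB b) (Base b) (rOp b) (rHist b) (hrOp b) (hrHist b) κ c ω (Window γ') κ E₀ θr)
    (Node00.W1.insAffine_histStepModel F M N k sp (Out b) (opA b) (opB b) (Base b) (rOp b) (rHist b) (hrOp b) (hrHist b) κ c ω (Window γ'))
    (Node00.W1.insBlind_histStepModel F M N k sp (Out b) (opA b) (opB b) (Base b) (rOp b) (rHist b) (hrOp b) (hrHist b) κ c ω (Window γ'))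
    (Node00.W1.insHomog_histStepModel F M N k sp (Out b) (opA b) (opB b) (Base b) (rOp b) (rHist b) (hrOp b) (hrHist b) κ c ω (Window γ'))
    (Node00.W1.insScaleBound_histStepModel F M N k sp (Out b) (opA b) (opB b) (Base b) (rOp b) (rHist b) (hrOp b) (hrHist b) κ c ω (Window γ') hc hω.le
      hE₁.le)
    hE₁ hδ0 hθ hθθ' hθ'1 hc hω hρ₀ l10near' hB l10first hS

end HistModel

/-! ## §4 At a Stage-13 tuple and a run length: N18's statement of record from the germ block -/

section Level

variable {N : ℕ} [NeZero N] {F : T4Family} (θ : Stage13Params F N) (k : ℕ)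
variable {Op : Type} [NormedAddCommGroup Op] [NormedSpace ℂ Op]

open Classical in
/-- ★ **THE JUNCTION AT GERM CARRIERS, ONE STAGE-13 TUPLE AND ONE RUN LENGTH** [bookkeeping; module 18 §1's `n18At_u3OfRecord₁₃_readingAdm_of_envelope_bound238`
with THE END's block (i) over `histCarriers` REPLACED by the germ block]: for the admissible reading of record `ReadingData.ofRecordAdm F θ.τ9.M N S sp gauge hg T₀ hT₀ li`
and a configuration transport `Tcfg` with its background face `hTcfg` (`Tcfg (ιU, 0) = (ι(T₀ k U), 0)` on admissible run-B backgrounds) and its table clause `hTsp`,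
IF (i)^germ — for every member `b ∈ ]0, γ′]` the history half of record `W1.histStepModel …` with NODE A's output map `Out b` represented by scale-`j` activities per germ
index (`hrep`) carrying the NODE-A majorant (`hH`), the representation leaves L01 ∕ L02 for the germ functionals `EAgerm (S k) Tcfg ∕ EBgerm (S (k+1)) b`, the base
leaf L03, the operator rate L07 (rows NE2 ∕ NE3), ONE set of located numerals, L10 and the sharp clause —, (ii) the (1.18) size classes of the two towers' terms on the
tables (`hszA`, `hszB`; W1-13), and (iii) the letters dominate (`θ.γ ≤ γ′`, `li.κ ≤ κ`, `θ′ ≤ li.θ₅`, `C₅(C₃ε₁) ≤ li.C₅`), THEN `N18At` holds at the Stage-13 bundle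
`u3OfRecord₁₃ θ (…u3Objects θ.γ) k` — by §3, W1-14's RESTRICTION FACE `ne5_readingAdm_of_germ`, module 18 §1's `Iff.rfl` face and `n18At_mono`.  NOT PRINTED; NOT
proved; no leaf is instanced on Bałaban's objects here (the displayed block is NODE A's ∕ NE2–NE3's; `Tcfg` is a parameter).
[cite: Balaban1987RG1, (1.18) p.263, (0.24)–(0.25) p.257 and Thm 1 p.259; Balaban1988RG2Cluster, (2.13)–(2.14) pp.14–15, (1.24) p.7 and Lemma 3 (2.38) p.20] -/
theorem n18At_u3OfRecord₁₃_readingAdm_of_germEnd (S : (k : ℕ) → ClusterTower (F.P k) (MatA N) θ.τ9.M)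
    (sp : (k j : ℕ) → (domSys (F.P k) θ.τ9.M j).Dom → Set (CPair (F.P k) (MatA N)))
    (gauge : (k : ℕ) → GaugeField (F.P k) 0 (Node00.SU N) → GaugeField (F.P k) 0 (Node00.SU N) → ℝ) (hg : ∀ k U U', 0 ≤ gauge k U U')
    (T₀ : (k : ℕ) → GaugeField (F.P (k + 1)) 0 (Node00.SU N) → GaugeField (F.P k) 0 (Node00.SU N))
    (hT₀ : ∀ (k : ℕ) (U : GaugeField (F.P (k + 1)) 0 (Node00.SU N)),
      (∀ (j : ℕ) (Y : (domSys (F.P (k + 1)) θ.τ9.M j).Dom), ofBackgroundC (ιSU N) U ∈ sp (k + 1) j Y) →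
        ∀ (j : ℕ) (X : (domSys (F.P k) θ.τ9.M j).Dom), ofBackgroundC (ιSU N) (T₀ k U) ∈ sp k j X)
    (li : LetterInputs) (Tcfg : CPair (F.P (k + 1)) (MatA N) → CPair (F.P k) (MatA N))
    (hTcfg : ∀ U : AdmBg F θ.τ9.M N sp (k + 1), Tcfg (ofBackgroundC (ιSU N) U.1) = ofBackgroundC (ιSU N) (T₀ k U.1))
    (hTsp : ∀ (X : Node00.W1.Dom (F.P k) θ.τ9.M) (ψ : CPair (F.P (k + 1)) (MatA N)),
      ψ ∈ sp (k + 1) (pairOfRecord F θ.τ9.M k X).1 (pairOfRecord F θ.τ9.M k X).2 → Tcfg ψ ∈ sp k X.1 X.2)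
    (Out : ℝ → ℕ → Op → GHist F θ.τ9.M N k sp → GermIdx F θ.τ9.M N k sp → ℂ) (opA opB : ℝ → (ℕ → ℝ) → Unit → ℕ → Op)
    (Base : ℝ → ℕ → (ℕ → ℝ) → Unit → Set (Op × GHist F θ.τ9.M N k sp)) (rOp rHist : ℝ → ℕ → ℝ) (hrOp : ∀ b n, 0 < rOp b n)
    (hrHist : ∀ b n, 0 < rHist b n) {κ c ω : ℝ}
    (act : ℝ → (I : GermIdx F θ.τ9.M N k sp) → Op × GHist F θ.τ9.M N k sp → TDom 4 (domCount (F.P k) θ.τ9.M I.1.1) → ℂ)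
    {γ' C3 ε₁ Rd EA₀ E₀ E₁ δ θr θ' ρ₀ B : ℝ} {k₀ : ℕ}
    (hrep : ∀ b : ℝ, 0 < b → b ≤ γ' → ∀ (I : GermIdx F θ.τ9.M N k sp) (z : Op × GHist F θ.τ9.M N k sp),
      Out b I.1.1 z.1 z.2 I =
        locE (TTouch (d := 4) (N := domCount (F.P k) θ.τ9.M I.1.1)) (fun Z : (tsys 4 (domCount (F.P k) θ.τ9.M I.1.1)).Dom => Z.1) (act b I z) I.1.2.1)
    (hC3 : 0 ≤ C3) (hε₁ : 0 ≤ ε₁) (hκ : 0 ≤ κ) (hrate : κ + 2 * (64 * Real.log 162) + 2 ≤ Rd)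
    (hKP : C3 * ε₁ * Real.exp (5 * κ + 1) * K₀ 64 8 * 9 * 64 ≤ 1)
    (hH : ∀ b : ℝ, 0 < b → b ≤ γ' → ∀ (I : GermIdx F θ.τ9.M N k sp), ∀ g ∈ Window γ', ∀ (U : Unit) (q : Op × GHist F θ.τ9.M N k sp),
      q ∈ Base b I.1.1 g U →
      ∃ V : Set (Op × GHist F θ.τ9.M N k sp), IsOpen V ∧
        (histStepModel F θ.τ9.M N k sp (Out b) (opA b) (opB b) (Base b) (rOp b) (rHist b) (hrOp b) (hrHist b) κ c ω).box I.1.1 q ⊆ V ∧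
        (∀ Z : TDom 4 (domCount (F.P k) θ.τ9.M I.1.1), DifferentiableOn ℂ (fun z : Op × GHist F θ.τ9.M N k sp => act b I z Z) V) ∧
        (∀ z ∈ V, ∀ Z : TDom 4 (domCount (F.P k) θ.τ9.M I.1.1), ‖act b I z Z‖ ≤ C3 * ε₁ * Real.exp (-(Rd * torusTreeLen Z.1))))
    (l01 : ∀ b : ℝ, 0 < b → b ≤ γ' →
      L01 (histStepModel F θ.τ9.M N k sp (Out b) (opA b) (opB b) (Base b) (rOp b) (rHist b) (hrOp b) (hrHist b) κ c ω)
        (EAgerm F θ.τ9.M N k sp (S k) Tcfg) (Window γ'))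
    (l02 : ∀ b : ℝ, 0 < b → b ≤ γ' →
      L02 (histStepModel F θ.τ9.M N k sp (Out b) (opA b) (opB b) (Base b) (rOp b) (rHist b) (hrOp b) (hrHist b) κ c ω)
        (EBgerm F θ.τ9.M N k sp (S (k + 1)) b) (Window γ'))
    (l03 : ∀ b : ℝ, 0 < b → b ≤ γ' →
      L03 (histStepModel F θ.τ9.M N k sp (Out b) (opA b) (opB b) (Base b) (rOp b) (rHist b) (hrOp b) (hrHist b) κ c ω)
        (EBgerm F θ.τ9.M N k sp (S (k + 1)) b) (Window γ'))
    (hszA : ∀ g ∈ Window γ', ∀ K : ℕ, (fun (j : Fin (K + 1)) Y ψ => termC (S k) j Y g ψ) ∈ SizeAdm (sp k) EA₀ κ K)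
    (hszB : ∀ b : ℝ, 0 < b → b ≤ γ' → ∀ g ∈ Window γ', ∀ K : ℕ,
      (fun (j : Fin (K + 1)) Y ψ => termC (S (k + 1)) j Y (prependCoupling b g) ψ) ∈ SizeAdm (sp (k + 1)) E₀ κ K)
    (l07 : ∀ b : ℝ, 0 < b → b ≤ γ' →
      L07 (histStepModel F θ.τ9.M N k sp (Out b) (opA b) (opB b) (Base b) (rOp b) (rHist b) (hrOp b) (hrHist b) κ c ω) (Window γ') δ θr)
    (hE₁ : 0 < E₁) (hδ : 0 ≤ δ) (hθ : 0 ≤ θr) (hθθ' : θr ≤ θ') (hθ'1 : θ' ≤ 1) (hc : 0 ≤ c) (hω : 0 < ω) (hρ₀ : ρ₀ < 1)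
    (l10near : δ * θr ^ k₀ + c * (EA₀ + E₀) / (1 - ω) ≤ ρ₀) (hB : 0 ≤ B) (l10first : ∀ k < k₀, EA₀ + E₀ ≤ B * θr ^ k)
    (hS : Real.exp 1 * 9 * 64 * K₀ 64 8 ^ 2 * C3 * c * ε₁ < (θ' - ω) * (1 - ρ₀))
    (hγ : θ.γ ≤ γ') (hℓκ : li.κ ≤ κ) (hℓθ : θ' ≤ li.θ₅)
    (hℓC : (Real.exp 1 * 9 * 64 * K₀ 64 8 ^ 2 * (C3 * ε₁) / (1 - ρ₀) * (δ + 0) + B) * (θ' - ω) /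
        (θ' - (ω + Real.exp 1 * 9 * 64 * K₀ 64 8 ^ 2 * (C3 * ε₁) / (1 - ρ₀) * c)) ≤ li.C₅) :
    N18At (u3OfRecord₁₃ θ ((ReadingData.ofRecordAdm F θ.τ9.M N S sp gauge hg T₀ hT₀ li).u3Objects θ.γ) k) := by
  rw [n18At_u3OfRecord₁₃_readingData_iff_pairing]
  intro b hb hbγ
  have hδ0 : 0 ≤ δ + 0 := by rw [add_zero]; exact hδ
  have h5 := ne5_germ_of_histStepModel F θ.τ9.M N k sp S Tcfg hTsp Out opA opB Base rOp rHist hrOp hrHist act hrep hC3 hε₁ hκ hrate hKP hH l01 l02 l03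
    hszA hszB l07 hE₁ hδ hθ hθθ' hθ'1 hc hω hρ₀ l10near hB l10first hS b hb (hbγ.trans hγ)
  have hrec := Node00.W1.ne5_readingAdm_of_germ S gauge hg T₀ hT₀ li θ.γ Tcfg hTcfg b (Window γ') κ θ' _ h5
  have hW : Window θ.γ ⊆ Window γ' := fun g hgW i => ⟨(hgW i).1, (hgW i).2.trans hγ⟩
  exact ne5_mono hrec hW hℓκ (hθ.trans hθθ') hℓθ (endConstant_nonneg hC3 hε₁ hδ0 hc hρ₀ hB hS) hℓC

end Level

end YMDAG.N18.W1Reading
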